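import Mathlib.MeasureTheory.Measure.Haar.NormedSpace
import Mathlib.MeasureTheory.Group.Integral
import Literature.Analysis.FunctionSpaces.TorusLatticeCells
import Literature.Analysis.FunctionSpaces.FlatTorusProofs
import HarnessLib

/-!
# Patching rescaled blocks on the cells of a tiling (BDL (4.3); ACM §6.2)

Trunk: Sobolev (`Literature/Analysis/FunctionSpaces`). The **patching operator** of the
(quasi-)self-similar constructions: given a mesh `m⁻¹`, an index map `ι` assigning a block
label to every cell of the tiling, and blocks `G_i : ℝ^d → X`, the patched function is
`y ↦ G_{ι(Q)}(m (y - r(Q)))` on the cell `Q ∋ y` (Bruè–De Lellis 2023, (4.3):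
`ρ_n(x,t) = Σ_{Q ∈ 𝒬(2·5ⁿ)} χ_Q(x) Θ_{i(Q)}(2·5ⁿ(x - r(Q)), t)`; Alberti–Crippa–Mazzucato 2019,
§6.2, (6.2)–(6.3): `ρ(t,x) := ρ^{j}(·, (x - r_Q)/λⁿ)` for `x ∈ Q ∈ 𝒯_{λⁿ}`).

* `Torus.cellIndex m y = ⌊m y⌋ ∈ ℤ^d` and `Torus.cellCoord m y = m y - ⌊m y⌋ ∈ [0,1)^d`: the
  cell of mesh `m⁻¹` containing `y ∈ ℝ^d` (`y ∈ Torus.latticeCell m (cellIndex m y)`) and the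
  local coordinate in it;
* `Torus.patch m ι G : ℝ^d → X`, `y ↦ G (ι (cellIndex m y)) (cellCoord m y)`, and its torus
  version `Torus.patchTorus m ι G : T^d → X` (through the fundamental-domain representative
  `Torus.repr`; only the labels `ι κ`, `0 ≤ κ < m`, matter);
* the cell formulas: on the half-open cell `Q_κ`, `patch m ι G y = G (ι κ) (m • y - κ)`
  (`Torus.patch_apply_of_mem_latticeCell`), locally around points of the open cell as an
  identity of germs (`Torus.patch_eventuallyEq`), and the lift identity
  `lift (patchTorus m ι G) = patch m (ι ∘ (· mod m)) G` (`Torus.lift_patchTorus`);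
* integrals: `∫_{Q_κ} g(m • y - κ) dy = m^{-d} ∫_{[0,1)^d} g`
  (`Torus.setIntegral_latticeCell_comp_rescale`), hence
  `∫_{T^d} patchTorus m ι G = m^{-d} Σ_{0 ≤ κ < m} ∫_{[0,1)^d} G (ι κ)`
  (`Torus.integral_patchTorus`);
* topology of the tiling: every half-open cell lies in the closure of its interior and the
  union of the open cells is dense (`Torus.dense_iUnion_latticeCellInterior`), so that
  identities and bounds proved in the open cells pass to the interfaces by continuity.

Smoothness of a patched function across the interfaces is NOT automatic (it is the
combinatorial heart of the Alberti–Crippa–Mazzucato construction, ACM §6.3 and §8.6) and is not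
asserted here.

## References

* E. Bruè, C. De Lellis, *Anomalous dissipation for the forced 3D Navier–Stokes equations*,
  Comm. Math. Phys. 400 (2023), §4, (4.3)–(4.4).
* G. Alberti, G. Crippa, A. L. Mazzucato, *Exponential self-similar mixing by incompressible
  flows*, J. Amer. Math. Soc. 32 (2019), Def. 7, §6.2 (6.2)–(6.3), §6.3.
-/

noncomputable section

open MeasureTheory Set Filter Module
open scoped Topology

namespace Literature.Analysis.FunctionSpaces

namespace Torus

variable {d : Type*} [Fintype d]

/-! ## Cell index and local coordinate -/

section CellIndex

/-- The multi-index `⌊m y⌋ ∈ ℤ^d` of the cell of mesh `m⁻¹` containing `y ∈ ℝ^d`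
(Bruè–De Lellis 2023, §4: `Q ∈ 𝒬(λ)` with `Q - r(Q) = (0, λ⁻¹)²`, `r(Q) = ⌊λ y⌋/λ`). [cite: BrueDeLellisCMP2023, §4] -/
def cellIndex (m : ℕ) (y : EuclideanSpace ℝ d) : d → ℤ := fun i => ⌊(m : ℝ) * y i⌋

variable [DecidableEq d]

/-- The local coordinate `m y - ⌊m y⌋ ∈ [0,1)^d` of `y` in its cell of mesh `m⁻¹`, i.e.
`m (y - r(Q))` (Bruè–De Lellis 2023, (4.3): the argument `2·5ⁿ(x - r(Q))` of the blocks). [cite: BrueDeLellisCMP2023, (4.3)] -/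
def cellCoord (m : ℕ) (y : EuclideanSpace ℝ d) : EuclideanSpace ℝ d :=
  (m : ℝ) • y - latticeVec (cellIndex m y)

variable {m : ℕ}

omit [Fintype d] [DecidableEq d] in
/-- Unfolding `cellIndex`. [folklore] -/
theorem cellIndex_apply (m : ℕ) (y : EuclideanSpace ℝ d) (i : d) :
    cellIndex m y i = ⌊(m : ℝ) * y i⌋ := rfl

/-- Coordinates of the local coordinate: `(cellCoord m y)ᵢ = m yᵢ - ⌊m yᵢ⌋ = fract (m yᵢ)`. [folklore] -/
theorem cellCoord_apply (m : ℕ) (y : EuclideanSpace ℝ d) (i : d) :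
    cellCoord m y i = Int.fract ((m : ℝ) * y i) := by
  rw [Int.fract, cellCoord, PiLp.sub_apply, PiLp.smul_apply, latticeVec_apply, cellIndex_apply,
    smul_eq_mul]

omit [Fintype d] [DecidableEq d] in
/-- On the half-open cell `Q_κ` the cell index is `κ`. [folklore] -/
theorem cellIndex_of_mem_latticeCell (hm : 0 < m) {κ : d → ℤ} {y : EuclideanSpace ℝ d}
    (hy : y ∈ latticeCell m κ) : cellIndex m y = κ := by
  have hm' : (0 : ℝ) < m := by exact_mod_cast hm
  funext i
  obtain ⟨h1, h2⟩ := hy i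
  rw [cellIndex_apply, Int.floor_eq_iff]
  rw [div_le_iff₀ hm'] at h1
  rw [lt_div_iff₀ hm'] at h2
  constructor <;> linarith

omit [Fintype d] [DecidableEq d] in
/-- Every point lies in the half-open cell of its index (`m ≥ 1`). [folklore] -/
theorem mem_latticeCell_cellIndex (hm : 0 < m) (y : EuclideanSpace ℝ d) :
    y ∈ latticeCell m (cellIndex m y) := by
  have hm' : (0 : ℝ) < m := by exact_mod_cast hm
  intro i
  rw [Set.mem_Ico, cellIndex_apply, div_le_iff₀ hm', lt_div_iff₀ hm', mul_comm (y i)]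
  exact ⟨Int.floor_le _, Int.lt_floor_add_one _⟩

/-- On the half-open cell `Q_κ` the local coordinate is the affine map `y ↦ m • y - κ`. [folklore] -/
theorem cellCoord_of_mem_latticeCell (hm : 0 < m) {κ : d → ℤ} {y : EuclideanSpace ℝ d}
    (hy : y ∈ latticeCell m κ) : cellCoord m y = (m : ℝ) • y - latticeVec κ := by
  rw [cellCoord, cellIndex_of_mem_latticeCell hm hy]

/-- The local coordinate lies in the fundamental cube `[0,1)^d`. [folklore] -/
theorem cellCoord_mem_unitCube (m : ℕ) (y : EuclideanSpace ℝ d) : cellCoord m y ∈ unitCube d :=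
  fun i => by
    rw [cellCoord_apply]
    exact ⟨Int.fract_nonneg _, Int.fract_lt_one _⟩

/-- A point of the cell `Q_κ` has rescaled position `m • y - κ` in the fundamental cube. [folklore] -/
theorem smul_sub_latticeVec_mem_unitCube (hm : 0 < m) {κ : d → ℤ} {y : EuclideanSpace ℝ d}
    (hy : y ∈ latticeCell m κ) : (m : ℝ) • y - latticeVec κ ∈ unitCube d := by
  rw [← cellCoord_of_mem_latticeCell hm hy]
  exact cellCoord_mem_unitCube m y

/-- Conversely, `m • y - κ ∈ [0,1)^d` iff `y ∈ Q_κ`. [folklore] -/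
theorem mem_latticeCell_iff_smul_sub_mem_unitCube (hm : 0 < m) (κ : d → ℤ)
    (y : EuclideanSpace ℝ d) : y ∈ latticeCell m κ ↔ (m : ℝ) • y - latticeVec κ ∈ unitCube d := by
  have hm' : (0 : ℝ) < m := by exact_mod_cast hm
  refine ⟨smul_sub_latticeVec_mem_unitCube hm, fun h i => ?_⟩
  have hi := h i
  simp only [PiLp.sub_apply, PiLp.smul_apply, smul_eq_mul, latticeVec_apply, Set.mem_Ico] at hi
  rw [Set.mem_Ico, div_le_iff₀ hm', lt_div_iff₀ hm', mul_comm (y i)]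
  constructor <;> linarith [hi.1, hi.2]

end CellIndex

/-! ## The patching operator -/

section Patch

variable [DecidableEq d] {I : Type*} {X : Type*}

/-- **Patching rescaled blocks on the cells of the tiling of mesh `m⁻¹`** (Bruè–De Lellis 2023,
(4.3); Alberti–Crippa–Mazzucato 2019, (6.2)–(6.3)): with block labels `ι : ℤ^d → I` and blocks
`G : I → ℝ^d → X`, `patch m ι G y = G (ι ⌊m y⌋) (m y - ⌊m y⌋)`, i.e. on the cell `Q_κ` the block
`G_{ι κ}` rescaled to `Q_κ`. The amplitude factor of the velocity (`(2·5ⁿ)⁻¹` in BDL (4.4)) is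
not built in. [cite: BrueDeLellisCMP2023, (4.3)] -/
def patch (m : ℕ) (ι : (d → ℤ) → I) (G : I → EuclideanSpace ℝ d → X) : EuclideanSpace ℝ d → X :=
  fun y => G (ι (cellIndex m y)) (cellCoord m y)

/-- The patched function on the torus `T^d`: `patch` evaluated at the fundamental-domain
representative `repr x ∈ [0,1)^d`, so that only the labels of the cells `Q_κ`, `0 ≤ κᵢ < m`,
matter (Bruè–De Lellis 2023, (4.3), read on `T²` after `1`-periodic extension, §5). [cite: BrueDeLellisCMP2023, (4.3)] -/
def patchTorus (m : ℕ) (ι : (d → ℤ) → I) (G : I → EuclideanSpace ℝ d → X) : UnitAddTorus d → X :=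
  fun x => patch m ι G (repr x)

variable {m : ℕ} {ι : (d → ℤ) → I} {G : I → EuclideanSpace ℝ d → X}

/-- Unfolding `patch`. [folklore] -/
theorem patch_apply (m : ℕ) (ι : (d → ℤ) → I) (G : I → EuclideanSpace ℝ d → X)
    (y : EuclideanSpace ℝ d) : patch m ι G y = G (ι (cellIndex m y)) (cellCoord m y) := rfl

/-- Unfolding `patchTorus`. [folklore] -/
theorem patchTorus_apply (m : ℕ) (ι : (d → ℤ) → I) (G : I → EuclideanSpace ℝ d → X)
    (x : UnitAddTorus d) : patchTorus m ι G x = patch m ι G (repr x) := rfl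

/-- Post-composition commutes with patching: `φ ∘ patch m ι G = patch m ι (φ ∘ G ·)`. [folklore] -/
theorem comp_patch {X' : Type*} (φ : X → X') (m : ℕ) (ι : (d → ℤ) → I)
    (G : I → EuclideanSpace ℝ d → X) : φ ∘ patch m ι G = patch m ι (fun i => φ ∘ G i) := rfl

/-- Post-composition commutes with patching on the torus. [folklore] -/
theorem comp_patchTorus {X' : Type*} (φ : X → X') (m : ℕ) (ι : (d → ℤ) → I)
    (G : I → EuclideanSpace ℝ d → X) :
    φ ∘ patchTorus m ι G = patchTorus m ι (fun i => φ ∘ G i) := rfl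

/-- **Cell formula**: on the half-open cell `Q_κ`, `patch m ι G y = G (ι κ) (m • y - κ)`. [folklore] -/
theorem patch_apply_of_mem_latticeCell (hm : 0 < m) {κ : d → ℤ} {y : EuclideanSpace ℝ d}
    (hy : y ∈ latticeCell m κ) : patch m ι G y = G (ι κ) ((m : ℝ) • y - latticeVec κ) := by
  rw [patch_apply, cellCoord_of_mem_latticeCell hm hy, cellIndex_of_mem_latticeCell hm hy]

/-- **Germ formula**: around a point of the open cell `Q°_κ`, the patched function is the
rescaled block `y ↦ G (ι κ) (m • y - κ)` (the open cell is open). [folklore] -/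
theorem patch_eventuallyEq (hm : 0 < m) {κ : d → ℤ} {y : EuclideanSpace ℝ d}
    (hy : y ∈ latticeCellInterior m κ) :
    patch m ι G =ᶠ[𝓝 y] fun y' => G (ι κ) ((m : ℝ) • y' - latticeVec κ) :=
  eventuallyEq_of_mem (isOpen_latticeCellInterior.mem_nhds hy) fun _ hy' =>
    patch_apply_of_mem_latticeCell hm (latticeCellInterior_subset hy')

/-- Pointwise bounds of the blocks on the fundamental cube transfer to the patched function. [folklore] -/
theorem norm_patch_le {X : Type*} [SeminormedAddCommGroup X] {G : I → EuclideanSpace ℝ d → X}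
    {M : ℝ} (hM : ∀ i, ∀ z ∈ unitCube d, ‖G i z‖ ≤ M) (y : EuclideanSpace ℝ d) :
    ‖patch m ι G y‖ ≤ M :=
  hM _ _ (cellCoord_mem_unitCube m y)

/-! ### The lift of the torus patch -/

/-- The representative of `proj y` is `y` shifted by the lattice vector `-⌊y⌋`. [folklore] -/
theorem repr_proj_eq_sub_floor (y : EuclideanSpace ℝ d) :
    repr (proj y) = y - latticeVec (fun i => ⌊y i⌋) := by
  obtain ⟨k, hk⟩ := exists_repr_proj_eq_add_latticeVec_holds (d := d) y
  have hmem := repr_mem_unitCube (proj y)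
  have hki : ∀ i, k i = -⌊y i⌋ := by
    intro i
    have h := hmem i
    rw [hk] at h
    simp only [PiLp.add_apply, latticeVec_apply, Set.mem_Ico] at h
    have h1 : ⌊y i + (k i : ℝ)⌋ = 0 := Int.floor_eq_zero_iff.2 ⟨h.1, h.2⟩
    rw [Int.floor_add_intCast] at h1
    omega
  rw [hk, sub_eq_add_neg, ← latticeVec_neg]
  congr 2
  funext i
  rw [Pi.neg_apply, hki]

/-- The cell index of the representative: `⌊m (yᵢ - ⌊yᵢ⌋)⌋ = ⌊m yᵢ⌋ mod m`. [folklore] -/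
theorem cellIndex_repr_proj (hm : 0 < m) (y : EuclideanSpace ℝ d) (i : d) :
    cellIndex m (repr (proj y)) i = cellIndex m y i % m := by
  have hm' : (0 : ℝ) < m := by exact_mod_cast hm
  have hmz : (m : ℤ) ≠ 0 := by exact_mod_cast hm.ne'
  rw [repr_proj_eq_sub_floor]
  simp only [cellIndex_apply, PiLp.sub_apply, latticeVec_apply, mul_sub]
  -- `⌊m y - m ⌊y⌋⌋ = ⌊m y⌋ - m ⌊y⌋`
  have h1 : ⌊(m : ℝ) * y i - (m : ℝ) * (⌊y i⌋ : ℝ)⌋ = ⌊(m : ℝ) * y i⌋ - (m : ℤ) * ⌊y i⌋ := by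
    have : (m : ℝ) * (⌊y i⌋ : ℝ) = (((m : ℤ) * ⌊y i⌋ : ℤ) : ℝ) := by push_cast; ring
    rw [this, Int.floor_sub_intCast]
  rw [h1]
  -- both sides are in `[0, m)` and congruent mod `m`
  have hr : 0 ≤ ⌊(m : ℝ) * y i⌋ - (m : ℤ) * ⌊y i⌋ ∧ ⌊(m : ℝ) * y i⌋ - (m : ℤ) * ⌊y i⌋ < m := by
    have hfl : (⌊y i⌋ : ℝ) ≤ y i := Int.floor_le _
    have hfl' : y i < ⌊y i⌋ + 1 := Int.lt_floor_add_one _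
    constructor
    · have : (m : ℤ) * ⌊y i⌋ ≤ ⌊(m : ℝ) * y i⌋ := by
        rw [Int.le_floor]; push_cast; nlinarith
      omega
    · have : ⌊(m : ℝ) * y i⌋ < (m : ℤ) * ⌊y i⌋ + m := by
        rw [Int.floor_lt]; push_cast; nlinarith
      omega
  obtain ⟨hr0, hrm⟩ := hr
  set r := ⌊(m : ℝ) * y i⌋ - (m : ℤ) * ⌊y i⌋ with hrdef
  have h2 : ⌊(m : ℝ) * y i⌋ = r + (m : ℤ) * ⌊y i⌋ := by omega
  rw [h2, Int.add_mul_emod_self_left, Int.emod_eq_of_lt hr0 hrm]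

/-- The local coordinate of the representative equals that of the point: `cellCoord` is
`ℤ^d`-periodic. [folklore] -/
theorem cellCoord_repr_proj (y : EuclideanSpace ℝ d) :
    cellCoord m (repr (proj y)) = cellCoord m y := by
  ext i
  rw [cellCoord_apply, cellCoord_apply, repr_proj_eq_sub_floor]
  simp only [PiLp.sub_apply, latticeVec_apply, mul_sub]
  have : (m : ℝ) * (⌊y i⌋ : ℝ) = (((m : ℤ) * ⌊y i⌋ : ℤ) : ℝ) := by push_cast; ring
  rw [this, Int.fract_sub_intCast]

/-- **Lift identity**: the periodic lift of the torus patch is the patch on `ℝ^d` with labels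
read modulo `m`, `lift (patchTorus m ι G) = patch m (ι ∘ (· mod m)) G`. [folklore] -/
theorem lift_patchTorus (hm : 0 < m) (ι : (d → ℤ) → I) (G : I → EuclideanSpace ℝ d → X) :
    lift (patchTorus m ι G) = patch m (fun κ => ι fun i => κ i % m) G := by
  funext y
  have hidx : cellIndex m (repr (proj y)) = fun i => cellIndex m y i % m :=
    funext fun i => cellIndex_repr_proj hm y i
  rw [lift_apply, patchTorus_apply, patch_apply, patch_apply, cellCoord_repr_proj, hidx]

omit [Fintype d] [DecidableEq d] in
/-- Multi-indices of cells of the fundamental cube (`0 ≤ κᵢ < m`) are unchanged by reduction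
modulo `m`. [folklore] -/
theorem finIndex_emod (κ : d → Fin m) :
    (fun i => ((κ i : ℕ) : ℤ) % (m : ℤ)) = fun i => ((κ i : ℕ) : ℤ) :=
  funext fun i => Int.emod_eq_of_lt (by positivity) (by exact_mod_cast (κ i).isLt)

/-- The torus patch at `proj y`, `y` in a cell `Q_κ` of the fundamental cube (`0 ≤ κ < m`):
`patchTorus m ι G (proj y) = G (ι κ) (m • y - κ)`. [folklore] -/
theorem patchTorus_proj_of_mem_latticeCell (hm : 0 < m) (κ : d → Fin m) {y : EuclideanSpace ℝ d}
    (hy : y ∈ latticeCell m (fun i => ((κ i : ℕ) : ℤ))) :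
    patchTorus m ι G (proj y) = G (ι fun i => ((κ i : ℕ) : ℤ))
      ((m : ℝ) • y - latticeVec (fun i => ((κ i : ℕ) : ℤ))) := by
  have h := congrFun (lift_patchTorus hm ι G) y
  rw [lift_apply] at h
  rw [h, patch_apply_of_mem_latticeCell hm hy]
  beta_reduce
  rw [finIndex_emod κ]

/-! ### Integrals of patched functions -/

variable [NormedAddCommGroup X] [NormedSpace ℝ X]

omit [NormedSpace ℝ X] in
/-- Integrability transported along the affine map of a cell: if `g` is integrable on `[0,1)^d`
then `y ↦ g(m • y - κ)` is integrable on `Q_κ`. [folklore] -/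
theorem integrableOn_latticeCell_comp_rescale (hm : 0 < m) (κ : d → ℤ)
    {g : EuclideanSpace ℝ d → X} (hg : IntegrableOn g (unitCube d) volume) :
    IntegrableOn (fun y => g ((m : ℝ) • y - latticeVec κ)) (latticeCell m κ) volume := by
  have hm' : (m : ℝ) ≠ 0 := by exact_mod_cast hm.ne'
  have hpre : latticeCell m κ = (fun y => (m : ℝ) • y - latticeVec κ) ⁻¹' unitCube d := by
    ext y; exact mem_latticeCell_iff_smul_sub_mem_unitCube hm κ y
  rw [← integrable_indicator_iff measurableSet_latticeCell, hpre]
  have hfun : ((fun y => (m : ℝ) • y - latticeVec κ) ⁻¹' unitCube d).indicator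
      (fun y => g ((m : ℝ) • y - latticeVec κ)) =
      fun y => (unitCube d).indicator g ((m : ℝ) • y - latticeVec κ) :=
    funext fun y => Set.indicator_comp_right (fun y => (m : ℝ) • y - latticeVec κ) (g := g)
  rw [hfun]
  have h1 : Integrable ((unitCube d).indicator g) volume :=
    (integrable_indicator_iff measurableSet_unitCube).2 hg
  have h2 : Integrable (fun w => (unitCube d).indicator g (w - latticeVec κ)) volume :=
    h1.comp_sub_right (latticeVec κ)
  exact h2.comp_smul hm'

/-- **Change of variables on a cell**: `∫_{Q_κ} g(m • y - κ) dy = m^{-d} ∫_{[0,1)^d} g`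
(the affine map `y ↦ m • y - κ` sends `Q_κ` onto `[0,1)^d` with Jacobian `m^d`). [folklore] -/
theorem setIntegral_latticeCell_comp_rescale (hm : 0 < m) (κ : d → ℤ)
    (g : EuclideanSpace ℝ d → X) :
    ∫ y in latticeCell m κ, g ((m : ℝ) • y - latticeVec κ) =
      ((m : ℝ) ^ Fintype.card d)⁻¹ • ∫ z in unitCube d, g z := by
  have hm' : (0 : ℝ) < m := by exact_mod_cast hm
  have hpre : latticeCell m κ = (fun y => (m : ℝ) • y - latticeVec κ) ⁻¹' unitCube d := by
    ext y; exact mem_latticeCell_iff_smul_sub_mem_unitCube hm κ y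
  calc ∫ y in latticeCell m κ, g ((m : ℝ) • y - latticeVec κ)
      = ∫ y, (latticeCell m κ).indicator (g ∘ fun y => (m : ℝ) • y - latticeVec κ) y :=
        (integral_indicator measurableSet_latticeCell).symm
    _ = ∫ y, (fun w => (unitCube d).indicator g (w - latticeVec κ)) ((m : ℝ) • y) := by
        rw [hpre]
        exact integral_congr_ae (ae_of_all _ fun y =>
          Set.indicator_comp_right (fun y => (m : ℝ) • y - latticeVec κ) (g := g))
    _ = |((m : ℝ) ^ finrank ℝ (EuclideanSpace ℝ d))⁻¹| •
          ∫ w, (unitCube d).indicator g (w - latticeVec κ) :=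
        Measure.integral_comp_smul (volume : Measure (EuclideanSpace ℝ d))
          (fun w => (unitCube d).indicator g (w - latticeVec κ)) (m : ℝ)
    _ = ((m : ℝ) ^ Fintype.card d)⁻¹ • ∫ w, (unitCube d).indicator g w := by
        rw [integral_sub_right_eq_self (fun w => (unitCube d).indicator g w) (latticeVec κ),
          finrank_euclideanSpace, abs_of_nonneg (inv_nonneg.2 (pow_nonneg hm'.le _))]
    _ = ((m : ℝ) ^ Fintype.card d)⁻¹ • ∫ z in unitCube d, g z := by
        rw [integral_indicator measurableSet_unitCube]

/-- The integral of the torus patch over a cell of the fundamental cube: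
`∫_{Q_κ} (patchTorus m ι G) ∘ proj = m^{-d} ∫_{[0,1)^d} G (ι κ)`. [folklore] -/
theorem setIntegral_latticeCell_patchTorus_proj (hm : 0 < m) (κ : d → Fin m) :
    ∫ y in latticeCell m (fun i => ((κ i : ℕ) : ℤ)), patchTorus m ι G (proj y) =
      ((m : ℝ) ^ Fintype.card d)⁻¹ • ∫ z in unitCube d, G (ι fun i => ((κ i : ℕ) : ℤ)) z := by
  rw [← setIntegral_latticeCell_comp_rescale hm _ (G (ι fun i => ((κ i : ℕ) : ℤ)))]
  refine setIntegral_congr_fun measurableSet_latticeCell fun y hy => ?_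
  exact patchTorus_proj_of_mem_latticeCell hm κ hy

/-- **Integral of a patched function** (Bruè–De Lellis 2023, proof of Thm. 4.1 (b): mean and
`L²` norm of `ρ_n` are sums over the `4·25ⁿ` cells of `m^{-2}` times those of the blocks):
`∫_{T^d} patchTorus m ι G = m^{-d} Σ_{0 ≤ κ < m} ∫_{[0,1)^d} G (ι κ)`, for blocks integrable on
the fundamental cube. [cite: BrueDeLellisCMP2023, Thm. 4.1 (b)] -/
theorem integral_patchTorus (hm : 0 < m)
    (hG : ∀ κ : d → Fin m, IntegrableOn (G (ι fun i => ((κ i : ℕ) : ℤ))) (unitCube d) volume) :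
    ∫ x, patchTorus m ι G x =
      ((m : ℝ) ^ Fintype.card d)⁻¹ • ∑ κ : d → Fin m, ∫ z in unitCube d, G (ι fun i => ((κ i : ℕ) : ℤ)) z := by
  rw [integral_eq_integral_lift_holds (patchTorus m ι G), Finset.smul_sum]
  have hint : IntegrableOn (lift (patchTorus m ι G)) (unitCube d) volume := by
    rw [unitCube_eq_iUnion_latticeCell hm]
    refine integrableOn_finite_iUnion.2 fun κ => ?_
    have h := (hG κ)
    -- transport integrability along the affine map of the cell
    have heq : EqOn (lift (patchTorus m ι G))
        (fun y => G (ι fun i => ((κ i : ℕ) : ℤ)) ((m : ℝ) • y - latticeVec fun i => ((κ i : ℕ) : ℤ)))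
        (latticeCell m fun i => ((κ i : ℕ) : ℤ)) := fun y hy => by
      rw [lift_apply]; exact patchTorus_proj_of_mem_latticeCell hm κ hy
    refine (IntegrableOn.congr_fun ?_ heq.symm measurableSet_latticeCell)
    exact integrableOn_latticeCell_comp_rescale hm _ h
  rw [setIntegral_unitCube_eq_sum_latticeCell hm hint]
  refine Finset.sum_congr rfl fun κ _ => ?_
  simp_rw [lift_apply]
  exact setIntegral_latticeCell_patchTorus_proj hm κ

end Patch

/-! ## Topology of the tiling: interfaces are limits of interior points -/

section Topology

variable {m : ℕ}

omit [Fintype d] in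
/-- The closure of an open cell is the closed cell `∏ᵢ [κᵢ/m, (κᵢ+1)/m]` (`m ≥ 1`). [folklore] -/
theorem closure_latticeCellInterior (hm : 0 < m) (κ : d → ℤ) :
    closure (latticeCellInterior (d := d) m κ) =
      {y | ∀ i, y i ∈ Icc ((κ i : ℝ) / m) ((κ i + 1 : ℝ) / m)} := by
  have hm' : (0 : ℝ) < m := by exact_mod_cast hm
  have hlt : ∀ i, (κ i : ℝ) / m < (κ i + 1 : ℝ) / m := fun i =>
    div_lt_div_of_pos_right (by linarith) hm'
  let e : EuclideanSpace ℝ d ≃ₜ (d → ℝ) := (PiLp.homeomorph 2 (fun _ : d => ℝ) : _)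
  have he : ∀ (y : EuclideanSpace ℝ d) (i : d), e y i = y i := fun _ _ => rfl
  have hpre : latticeCellInterior (d := d) m κ =
      e ⁻¹' Set.pi univ fun i => Ioo ((κ i : ℝ) / m) ((κ i + 1 : ℝ) / m) := by
    ext y; simp [latticeCellInterior, he]
  rw [hpre, ← e.preimage_closure, closure_pi_set]
  ext y
  simp only [Set.mem_preimage, Set.mem_univ_pi, closure_Ioo (hlt _).ne, mem_setOf_eq, he]

omit [Fintype d] in
/-- A half-open cell lies in the closure of its interior (`m ≥ 1`). [folklore] -/
theorem latticeCell_subset_closure_interior (hm : 0 < m) (κ : d → ℤ) :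
    latticeCell (d := d) m κ ⊆ closure (latticeCellInterior m κ) := by
  rw [closure_latticeCellInterior hm κ]
  exact fun y hy i => Ico_subset_Icc_self (hy i)

omit [Fintype d] in
/-- **The open cells are dense**: every point of `ℝ^d` is a limit of points of the open cells of
the tiling of mesh `m⁻¹` (`m ≥ 1`). [folklore] -/
theorem dense_iUnion_latticeCellInterior (hm : 0 < m) :
    Dense (⋃ κ : d → ℤ, latticeCellInterior (d := d) m κ) := by
  intro y
  have h1 : y ∈ closure (latticeCellInterior m (cellIndex m y)) :=
    latticeCell_subset_closure_interior hm _ (mem_latticeCell_cellIndex hm y)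
  exact closure_mono (subset_iUnion (fun κ : d → ℤ => latticeCellInterior (d := d) m κ) _) h1

omit [Fintype d] in
/-- Two continuous maps on `ℝ^d` that agree on every open cell agree everywhere. [folklore] -/
theorem eq_of_forall_eqOn_latticeCellInterior {Z : Type*} [TopologicalSpace Z] [T2Space Z]
    (hm : 0 < m) {g g' : EuclideanSpace ℝ d → Z} (hg : Continuous g) (hg' : Continuous g')
    (h : ∀ κ : d → ℤ, EqOn g g' (latticeCellInterior m κ)) : g = g' :=
  Continuous.ext_on (dense_iUnion_latticeCellInterior hm) hg hg' fun y hy => by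
    obtain ⟨κ, hκ⟩ := mem_iUnion.1 hy
    exact h κ hκ

omit [Fintype d] in
/-- A continuous map that agrees with a continuous "cell formula" on the open cell agrees with
it on the whole half-open cell (interfaces included). [folklore] -/
theorem eqOn_latticeCell_of_eqOn_interior {Z : Type*} [TopologicalSpace Z] [T2Space Z]
    (hm : 0 < m) {κ : d → ℤ} {g g' : EuclideanSpace ℝ d → Z} (hg : Continuous g)
    (hg' : Continuous g') (h : EqOn g g' (latticeCellInterior m κ)) :
    EqOn g g' (latticeCell m κ) :=
  (h.closure hg hg').mono (latticeCell_subset_closure_interior hm κ)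

end Topology

end Torus

end Literature.Analysis.FunctionSpaces
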